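import Literature.Geometry.Lorentzian.Hypersurface
import Literature.Topology.FourManifolds.ImmersionCriterion
import HarnessLib

/-!
# Spacelike immersions are immersions in Mathlib's chart sense (discharge)

This file discharges the named fact
`Literature.Geometry.Lorentzian.PseudoRiemannianMetric.IsSpacelikeImmersion.isImmersion` of
`Hypersurface.lean`: a spacelike immersion `f : N → (M, g)` between boundaryless manifolds
modelled on finite-dimensional real vector spaces (`g` a `C^n` pseudo-Riemannian metric,
`n ≠ ω`) is a `C^{n+1}` immersion in the sense of Mathlib's `Manifold.IsImmersion` (charts of
the maximal atlases in which `f` reads `u ↦ equiv (u, 0)`).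

Proof. A spacelike immersion is `C^{n+1}` (`IsSpacelikeImmersion.contMDiff`) with everywhere
injective differential (`IsSpacelikeImmersion.injective_mfderiv`: `df v = 0` forces
`g(df v, df v) = 0`, hence `v = 0`), and O'Neill's Lemma 1.33 (a smooth map whose differential
at `p` is one-to-one reads, in suitable coordinates, as the standard inclusion
`(a₁, …, aₘ) ↦ (a₁, …, aₘ, 0, …, 0)`; Lee, *Introduction to Smooth Manifolds*, Thm. 4.12) is the
tree's immersion criterion `Literature.Topology.FourManifolds.isImmersion_of_injective_mfderiv`
(`ImmersionCriterion.lean`, inverse function theorem in charts). The only bookkeeping is the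
passage from the ambient `C^∞` manifold structures to the `C^{n+1}` ones (`n ≠ ω` gives
`n + 1 ≤ ∞`, `IsManifold.of_le`).

It lives in a sibling file because the immersion criterion imports the differential-topology
infrastructure of `Literature/Topology/FourManifolds`, which `Hypersurface.lean` and its many
importers do not need.

## References

* B. O'Neill, *Semi-Riemannian geometry with applications to relativity*, Academic Press 1983,
  Ch. 1, Lemma 33 and Def. 34, pp. 19–20 (immersions; "Lemma 33(3) says that locally every
  immersion looks like" the standard inclusion). [ONeillSemiRiemannian1983]
* J. M. Lee, *Introduction to Smooth Manifolds*, 2nd ed., GTM 218 (2013), Thm. 4.12.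
  [LeeSmoothManifolds2013]
-/

noncomputable section

open Bundle Set Manifold
open scoped ContDiff Topology

namespace Literature.Geometry.Lorentzian

variable {E : Type*} [NormedAddCommGroup E] [NormedSpace ℝ E] {H : Type*} [TopologicalSpace H]
  {I : ModelWithCorners ℝ E H} {M : Type*} [TopologicalSpace M] [ChartedSpace H M]
  {E' : Type*} [NormedAddCommGroup E'] [NormedSpace ℝ E'] {H' : Type*} [TopologicalSpace H']
  {I' : ModelWithCorners ℝ E' H'} {N : Type*} [TopologicalSpace N] [ChartedSpace H' N]
  [IsManifold I ∞ M] {n : ℕ∞ω}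

namespace PseudoRiemannianMetric.IsSpacelikeImmersion

variable (I') (g : PseudoRiemannianMetric I n E (TangentSpace I : M → Type _)) (f : N → M)

/-- **Discharge of `IsSpacelikeImmersion.isImmersion`.** A spacelike immersion `f : N → (M, g)`
between boundaryless manifolds modelled on finite-dimensional real vector spaces (`g` of class
`C^n`, `n ≠ ω`) is a `C^{n+1}` immersion in Mathlib's chart sense `Manifold.IsImmersion I' I
(n + 1) f`: `f` is `C^{n+1}` with injective differential at every point, so O'Neill's Lemma 1.33
/ the local immersion theorem (the tree's
`Literature.Topology.FourManifolds.isImmersion_of_injective_mfderiv`) applies to the `C^{n+1}`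
structures underlying the smooth ones (`IsManifold.of_le`, `n + 1 ≤ ∞`). O'Neill 1983, Ch. 1,
Lemma 33 and Def. 34, pp. 19–20; Lee 2013, Thm. 4.12.
[cite: ONeillSemiRiemannian1983, Ch. 1, Lemma 33 and Def. 34, pp. 19–20] -/
theorem isImmersion_holds : isImmersion I' g f := by
  intro _ _ _ _ _ hn hf
  have hle : n + 1 ≤ ∞ := by
    obtain ⟨m, rfl⟩ := WithTop.ne_top_iff_exists.mp hn
    exact_mod_cast le_top
  haveI : IsManifold I' (n + 1) N := IsManifold.of_le hle
  haveI : IsManifold I (n + 1) M := IsManifold.of_le hle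
  exact Literature.Topology.FourManifolds.isImmersion_of_injective_mfderiv hf.contMDiff
    le_add_self hf.injective_mfderiv

end PseudoRiemannianMetric.IsSpacelikeImmersion

end Literature.Geometry.Lorentzian

end
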